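import Literature.NumberTheory.DiophantineGeometry.GenEllMell
import Mathlib.Analysis.Complex.ExponentialBounds
import HarnessLib

/-!
# [GenEll] Cor. 4.3: the primes of potentially multiplicative reduction and the local heights cost at most `(1 + 3/2) · d · deg_∞`

Topic `NumberTheory/DiophantineGeometry`.  Theorem-only companion to `GenEllMell.lean` (no
definition, no named fact).

For a presented elliptic curve `P = (E/F)` (`GenEll.EllPoint`), write `d = [F:ℚ]`, `𝔇 = 𝔇_j` for
the denominator ideal of `j(E)` (so `d · deg_∞(P) = log N(𝔇)`, `GenEll.EllPoint.degInf`),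
`h_v = -ord_v(j(E))` for the local height at a finite prime `v` (`GenEll.EllPoint.localHeight`),
and `T = {v | h_v > 0}` for the primes of potentially multiplicative reduction
(`GenEll.EllPoint.IsPotMult`).  Then:

* `jDenominatorIdeal_le_pow_of_isPotMult` — `𝔇 ⊆ v^{h_v}` for `v ∈ T`; hence `T` is finite
  (`finite_setOf_isPotMult`) and `∑_{v ∈ T} h_v · log N(v) ≤ log N(𝔇)`
  (`sum_localHeight_mul_log_absNorm_le`);
* `sum_log_le_log_absNorm_jDenominatorIdeal_of_isPotMult` — distinct rational primes `p` lying
  under primes of `T`: `∑ log p ≤ log N(𝔇)` (the first inequality of [GenEll] Lemma 4.2,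
  `∑ log p_j ≤ h`);
* `sum_log_le_of_dvd_localHeight` — distinct rational primes `q` dividing some `h_v`, `v ∈ T`:
  `∑ log q ≤ (3/2) · log N(𝔇)` (the second/third inequalities of Lemma 4.2,
  `∑ log h_j ≤ 3h/2`);
* `sum_log_le_five_halves_mul_log_absNorm_jDenominatorIdeal` and the `deg_∞`-form
  `sum_log_le_five_halves_mul_degree_mul_degInf` — both kinds together:
  `∑ log p ≤ (1 + 3/2) · log N(𝔇) = (5/2) · d · deg_∞(P)`.

This is the estimate "`x_{S°} ≤ x_S + (1 + 3/2) · 23040 d · deg_∞([E_L])`" of the proof of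
[GenEll] Corollary 4.3 (p. 22), in the tree's rendering of local heights through `ord_v(j)` over the
presenting field itself (which makes the factor `23040` unnecessary).

## References

* S. Mochizuki, *Arithmetic elliptic curves in general position*, Math. J. Okayama Univ. 52
  (2010), Lemma 4.2 and the proof of Corollary 4.3, pp. 21–23. [MochizukiGenEll2010]
-/

noncomputable section

open NumberField Ideal IsDedekindDomain Finset

namespace Literature.NumberTheory.DiophantineGeometry.GenEll

namespace EllPoint

variable (P : EllPoint)

/-- `n ≤ ord_v(x)` iff `x ∈ v^n`, for a non-zero integer `x`. [folklore] -/
private theorem natCast_le_ord_iff_mem_pow (v : HeightOneSpectrum (𝓞 P.F)) (x : 𝓞 P.F)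
    (hx : x ≠ 0) (n : ℕ) :
    (n : ℤ) ≤ Literature.IUT.LogVolume.ord P.F v (x : P.F) ↔ x ∈ v.asIdeal ^ n := by
  unfold Literature.IUT.LogVolume.ord
  rw [HeightOneSpectrum.valuation_of_algebraMap, ← HeightOneSpectrum.intValuation_le_pow_iff_mem,
    le_neg, WithZero.log_le_iff_le_exp (v.intValuation_ne_zero x hx)]

/-- **`𝔇_j ⊆ v^{h_v}` at a prime of potentially multiplicative reduction**: if `h_v = -ord_v(j) > 0`
then every `a ∈ 𝓞_F` with `a · j ∈ 𝓞_F` has `ord_v(a) ≥ h_v`.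
[cite: MochizukiGenEll2010, Def 3.3 and Rmk 3.3.1, pp. 15–16] -/
theorem jDenominatorIdeal_le_pow_of_isPotMult (v : HeightOneSpectrum (𝓞 P.F)) (hv : P.IsPotMult v) :
    P.W.jDenominatorIdeal ≤ v.asIdeal ^ (P.localHeight v).toNat := by
  intro a ha
  rw [WeierstrassCurve.mem_jDenominatorIdeal] at ha
  obtain ⟨b, hb⟩ := ha
  by_cases ha0 : a = 0
  · rw [ha0]; exact Ideal.zero_mem _
  have hj0 : P.W.j ≠ 0 := by
    intro hj
    have : P.localHeight v = 0 := by
      simp [EllPoint.localHeight, hj, Literature.IUT.LogVolume.ord_zero]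
    simp [EllPoint.IsPotMult, this] at hv
  have ha0' : (a : P.F) ≠ 0 := by exact_mod_cast ha0
  have hb0 : b ≠ 0 := by
    rintro rfl
    simp [ha0', hj0] at hb
  rw [← natCast_le_ord_iff_mem_pow P v a ha0]
  have hord := Literature.IUT.LogVolume.ord_mul P.F v ha0' hj0
  rw [hb] at hord
  have hbnn := Literature.IUT.LogVolume.ord_nonneg_of_isIntegral P.F v b
  have hpos : 0 < P.localHeight v := hv
  simp only [EllPoint.localHeight] at hpos ⊢
  rw [Int.toNat_of_nonneg hpos.le]
  linarith

/-- At a prime of potentially multiplicative reduction, `𝔇_j ⊆ v`. [cite: MochizukiGenEll2010, Rmk 3.3.1, p. 16] -/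
theorem jDenominatorIdeal_le_of_isPotMult (v : HeightOneSpectrum (𝓞 P.F)) (hv : P.IsPotMult v) :
    P.W.jDenominatorIdeal ≤ v.asIdeal := by
  have h := P.jDenominatorIdeal_le_pow_of_isPotMult v hv
  have hpos : 0 < (P.localHeight v).toNat := by
    have : 0 < P.localHeight v := hv
    omega
  exact h.trans (Ideal.pow_le_self hpos.ne')

/-- **The primes of potentially multiplicative reduction form a finite set** (they divide `𝔇_j ≠ 0`).
[cite: MochizukiGenEll2010, Rmk 3.3.1, p. 16] -/
theorem finite_setOf_isPotMult : {v : HeightOneSpectrum (𝓞 P.F) | P.IsPotMult v}.Finite := by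
  refine (Ideal.finite_factors P.W.jDenominatorIdeal_ne_bot).subset ?_
  intro v hv
  exact Ideal.dvd_iff_le.mpr (P.jDenominatorIdeal_le_of_isPotMult v hv)

/-- A number ring has a finite prime. [folklore] -/
private theorem nonempty_heightOneSpectrum : Nonempty (HeightOneSpectrum (𝓞 P.F)) := by
  obtain ⟨𝔪, h𝔪⟩ := Ideal.exists_maximal (𝓞 P.F)
  exact ⟨⟨𝔪, h𝔪.isPrime,
    Ring.ne_bot_of_isMaximal_of_not_isField h𝔪 (RingOfIntegers.not_isField P.F)⟩⟩

/-- The norm of the denominator ideal of `j` is positive. [folklore] -/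
private theorem absNorm_jDenominatorIdeal_pos : 0 < absNorm P.W.jDenominatorIdeal :=
  Nat.pos_of_ne_zero (mt absNorm_eq_zero_iff.mp P.W.jDenominatorIdeal_ne_bot)

/-- `N(v) ≥ 2` for a finite prime `v`. [folklore] -/
private theorem two_le_absNorm (v : HeightOneSpectrum (𝓞 P.F)) : (2 : ℝ) ≤ absNorm v.asIdeal := by
  exact_mod_cast NumberField.HeightOneSpectrum.one_lt_absNorm v

/-- **`∑_{v ∈ T} h_v · log N(v) ≤ log N(𝔇_j) = d · deg_∞`** for any finite set `T` of primes of
potentially multiplicative reduction (`∏ v^{h_v} ∣ 𝔇_j` by coprimality). This is the quantity `h`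
of [GenEll] Lemma 4.2 as it enters the proof of Cor. 4.3 ("the `h` of Lemma 4.2 corresponds to
`23040 d · deg_∞([E_L])`"). [cite: MochizukiGenEll2010, proof of Cor. 4.3, pp. 22–23] -/
theorem sum_localHeight_mul_log_absNorm_le (T : Finset (HeightOneSpectrum (𝓞 P.F)))
    (hT : ∀ v ∈ T, P.IsPotMult v) :
    ∑ v ∈ T, (P.localHeight v : ℝ) * Real.log (absNorm v.asIdeal) ≤
      Real.log (absNorm P.W.jDenominatorIdeal) := by
  have hdvd : (∏ v ∈ T, v.asIdeal ^ (P.localHeight v).toNat) ∣ P.W.jDenominatorIdeal := by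
    refine Finset.prod_dvd_of_coprime ?_ ?_
    · intro v _ w _ hne
      have hne' : v.asIdeal ≠ w.asIdeal := fun h => hne (HeightOneSpectrum.ext h)
      exact (Ideal.isCoprime_iff_sup_eq.mpr (v.isMaximal.coprime_of_ne w.isMaximal hne')).pow
    · intro v hv
      exact Ideal.dvd_iff_le.mpr (P.jDenominatorIdeal_le_pow_of_isPotMult v (hT v hv))
  have hN := map_dvd Ideal.absNorm hdvd
  rw [map_prod] at hN
  simp only [map_pow] at hN
  have hle : ((∏ v ∈ T, absNorm v.asIdeal ^ (P.localHeight v).toNat : ℕ) : ℝ) ≤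
      absNorm P.W.jDenominatorIdeal := by
    exact_mod_cast Nat.le_of_dvd (absNorm_jDenominatorIdeal_pos P) hN
  have hpos : ∀ v ∈ T, (0 : ℝ) < absNorm v.asIdeal := fun v _ => by
    linarith [two_le_absNorm P v]
  calc ∑ v ∈ T, (P.localHeight v : ℝ) * Real.log (absNorm v.asIdeal)
      = Real.log (∏ v ∈ T, (absNorm v.asIdeal : ℝ) ^ (P.localHeight v).toNat) := by
        rw [Real.log_prod]
        · refine Finset.sum_congr rfl fun v hv => ?_
          have h0 : 0 ≤ P.localHeight v := le_of_lt (hT v hv)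
          rw [Real.log_pow]
          congr 1
          exact_mod_cast (Int.toNat_of_nonneg h0).symm
        · intro v hv
          exact pow_ne_zero _ (hpos v hv).ne'
    _ ≤ Real.log (absNorm P.W.jDenominatorIdeal) := by
        refine Real.log_le_log (Finset.prod_pos fun v hv => pow_pos (hpos v hv) _) ?_
        push_cast at hle
        exact hle

/-- If a rational prime `p` lies in a finite prime `v` of `𝓞_F`, then `p ≤ N(v)` (indeed
`p ∣ N(v)`). [folklore] -/
private theorem cast_le_absNorm_of_mem {p : ℕ} (hp : p.Prime) (v : HeightOneSpectrum (𝓞 P.F))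
    (hmem : (p : 𝓞 P.F) ∈ v.asIdeal) : (p : ℝ) ≤ absNorm v.asIdeal := by
  haveI := v.isMaximal
  have hmax : (Ideal.span {(p : ℤ)}).IsMaximal :=
    Ideal.IsPrime.isMaximal (Ideal.span_singleton_prime (by exact_mod_cast hp.ne_zero) |>.mpr
      (Nat.prime_iff_prime_int.mp hp)) (by simpa using hp.ne_zero)
  have hunder : v.asIdeal.under ℤ = Ideal.span {(p : ℤ)} := by
    refine (hmax.eq_of_le (IsPrime.under ℤ v.asIdeal).ne_top ?_).symm
    rw [Ideal.span_singleton_le_iff_mem, Ideal.under_def, Ideal.mem_comap, map_natCast]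
    exact hmem
  have h2 : (absNorm v.asIdeal : ℤ) ∈ v.asIdeal.under ℤ := by
    rw [Ideal.under_def, Ideal.mem_comap, map_natCast]
    exact Ideal.absNorm_mem v.asIdeal
  rw [hunder, Ideal.mem_span_singleton] at h2
  have hdvd : p ∣ absNorm v.asIdeal := by exact_mod_cast h2
  have hne : absNorm v.asIdeal ≠ 0 := by
    have := two_le_absNorm P v
    intro h; rw [h] at this; norm_num at this
  exact_mod_cast Nat.le_of_dvd (Nat.pos_of_ne_zero hne) hdvd

/-- Two rational primes lying in the same finite prime are equal. [folklore] -/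
private theorem eq_of_mem_of_mem {p q : ℕ} (hp : p.Prime) (hq : q.Prime)
    (v : HeightOneSpectrum (𝓞 P.F)) (hpv : (p : 𝓞 P.F) ∈ v.asIdeal) (hqv : (q : 𝓞 P.F) ∈ v.asIdeal) :
    p = q := by
  by_contra hne
  have hcop : Nat.Coprime p q := (Nat.coprime_primes hp hq).mpr hne
  obtain ⟨a, b, hab⟩ := Nat.isCoprime_iff_coprime.mpr hcop
  have h1 : ((a * p + b * q : ℤ) : 𝓞 P.F) ∈ v.asIdeal := by
    push_cast
    exact v.asIdeal.add_mem (v.asIdeal.mul_mem_left _ (by exact_mod_cast hpv))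
      (v.asIdeal.mul_mem_left _ (by exact_mod_cast hqv))
  rw [hab] at h1
  simp only [Int.cast_one] at h1
  exact v.isMaximal.ne_top ((Ideal.eq_top_iff_one _).mpr h1)

/-- **Primes under primes of potentially multiplicative reduction cost at most `log N(𝔇_j)`**
(first inequality of [GenEll] Lemma 4.2, `∑ log p_j ≤ h`, in the setting of Cor. 4.3): for a finite
set `A` of rational primes each lying under some prime `v` with `h_v > 0`,
`∑_{p ∈ A} log p ≤ log N(𝔇_j)`. [cite: MochizukiGenEll2010, Lem 4.2 p. 21, proof of Cor. 4.3 p. 22] -/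
theorem sum_log_le_log_absNorm_jDenominatorIdeal_of_isPotMult (A : Finset ℕ)
    (hA : ∀ p ∈ A, p.Prime ∧ ∃ v : HeightOneSpectrum (𝓞 P.F), P.IsPotMult v ∧
      (p : 𝓞 P.F) ∈ v.asIdeal) :
    ∑ p ∈ A, Real.log p ≤ Real.log (absNorm P.W.jDenominatorIdeal) := by
  classical
  have hch : ∀ p : ℕ, ∃ v : HeightOneSpectrum (𝓞 P.F), p ∈ A → P.IsPotMult v ∧
      (p : 𝓞 P.F) ∈ v.asIdeal := by
    intro p
    by_cases hp : p ∈ A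
    · obtain ⟨-, v, hv⟩ := hA p hp
      exact ⟨v, fun _ => hv⟩
    · obtain ⟨v⟩ := nonempty_heightOneSpectrum P
      exact ⟨v, fun h => absurd h hp⟩
  choose V hV using hch
  have hinj : Set.InjOn V A := by
    intro p hp q hq hpq
    exact eq_of_mem_of_mem P (hA p hp).1 (hA q hq).1 (V q) (hpq ▸ (hV p hp).2) (hV q hq).2
  calc ∑ p ∈ A, Real.log p
      ≤ ∑ p ∈ A, (P.localHeight (V p) : ℝ) * Real.log (absNorm (V p).asIdeal) := by
        refine Finset.sum_le_sum fun p hp => ?_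
        have hprime := (hA p hp).1
        have hp0 : (0 : ℝ) < p := by exact_mod_cast hprime.pos
        have hlogp : 0 ≤ Real.log p := Real.log_nonneg (by exact_mod_cast hprime.one_lt.le)
        have hN : (p : ℝ) ≤ absNorm (V p).asIdeal := cast_le_absNorm_of_mem P hprime (V p) (hV p hp).2
        have hh : (1 : ℝ) ≤ P.localHeight (V p) := by
          have : 0 < P.localHeight (V p) := (hV p hp).1
          exact_mod_cast this
        calc Real.log p = 1 * Real.log p := (one_mul _).symm
          _ ≤ (P.localHeight (V p) : ℝ) * Real.log (absNorm (V p).asIdeal) :=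
            mul_le_mul hh (Real.log_le_log hp0 hN) hlogp (by linarith)
    _ = ∑ v ∈ A.image V, (P.localHeight v : ℝ) * Real.log (absNorm v.asIdeal) := by
        rw [Finset.sum_image hinj]
    _ ≤ Real.log (absNorm P.W.jDenominatorIdeal) := by
        refine P.sum_localHeight_mul_log_absNorm_le _ ?_
        intro v hv
        obtain ⟨p, hp, rfl⟩ := Finset.mem_image.mp hv
        exact (hV p hp).1

/-- **Primes dividing the local heights cost at most `(3/2) · log N(𝔇_j)`** (second and third
inequalities of [GenEll] Lemma 4.2, `∑ log h_j ≤ ∑ log (h_j + 1) ≤ 3h/2`, in the setting of Cor. 4.3):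
for a finite set `A` of rational primes each dividing some local height `h_v > 0`,
`∑_{q ∈ A} log q ≤ (3/2) · log N(𝔇_j)` (the `q` with a common witness `v` have product `∣ h_v`, and
`log h_v ≤ h_v - 1 ≤ h_v · log N(v) / log 2 ≤ (3/2) · h_v · log N(v)`).
[cite: MochizukiGenEll2010, Lem 4.2 p. 21, proof of Cor. 4.3 p. 22] -/
theorem sum_log_le_of_dvd_localHeight (A : Finset ℕ)
    (hA : ∀ q ∈ A, q.Prime ∧ ∃ v : HeightOneSpectrum (𝓞 P.F), P.IsPotMult v ∧
      (q : ℤ) ∣ P.localHeight v) :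
    ∑ q ∈ A, Real.log q ≤ 3 / 2 * Real.log (absNorm P.W.jDenominatorIdeal) := by
  classical
  have hch : ∀ q : ℕ, ∃ v : HeightOneSpectrum (𝓞 P.F), q ∈ A → P.IsPotMult v ∧
      (q : ℤ) ∣ P.localHeight v := by
    intro q
    by_cases hq : q ∈ A
    · obtain ⟨-, v, hv⟩ := hA q hq
      exact ⟨v, fun _ => hv⟩
    · obtain ⟨v⟩ := nonempty_heightOneSpectrum P
      exact ⟨v, fun h => absurd h hq⟩
  choose V hV using hch
  have hlog2 : 0 < Real.log 2 := Real.log_pos (by norm_num)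
  set T := A.image V with hT
  have hTpot : ∀ v ∈ T, P.IsPotMult v := by
    intro v hv
    obtain ⟨q, hq, rfl⟩ := Finset.mem_image.mp hv
    exact (hV q hq).1
  -- each fibre: `∑_{q ↦ v} log q ≤ log h_v ≤ h_v - 1`
  have hfib : ∀ v ∈ T, ∀ B : Finset ℕ, B ⊆ A → (∀ q ∈ B, V q = v) →
      ∑ q ∈ B, Real.log q ≤ (P.localHeight v : ℝ) - 1 := by
    intro v hv B hBA hBv
    have hh : 0 < P.localHeight v := hTpot v hv
    have h2 : ((P.localHeight v).toNat : ℤ) = P.localHeight v := Int.toNat_of_nonneg hh.le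
    have hprod : (∏ q ∈ B, q) ∣ (P.localHeight v).toNat := by
      refine Finset.prod_primes_dvd _ ?_ ?_
      · intro q hq
        exact Nat.prime_iff.mp (hA q (hBA hq)).1
      · intro q hq
        have hd := (hV q (hBA hq)).2
        rw [hBv q hq, ← h2] at hd
        exact_mod_cast hd
    have hle : (∏ q ∈ B, (q : ℝ)) ≤ P.localHeight v := by
      have h3 := Nat.le_of_dvd (by omega) hprod
      have h4 : ((∏ q ∈ B, q : ℕ) : ℝ) ≤ ((P.localHeight v).toNat : ℝ) := by exact_mod_cast h3
      have h5 : ((P.localHeight v).toNat : ℝ) = (P.localHeight v : ℝ) := by exact_mod_cast h2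
      rw [h5] at h4
      simpa [Nat.cast_prod] using h4
    have hpos : ∀ q ∈ B, (0 : ℝ) < q := by
      intro q hq
      exact_mod_cast (hA q (hBA hq)).1.pos
    calc ∑ q ∈ B, Real.log q
        = Real.log (∏ q ∈ B, (q : ℝ)) := by
          rw [Real.log_prod]
          intro q hq
          exact (hpos q hq).ne'
      _ ≤ Real.log (P.localHeight v) := Real.log_le_log (Finset.prod_pos hpos) hle
      _ ≤ (P.localHeight v : ℝ) - 1 := Real.log_le_sub_one_of_pos (by exact_mod_cast hh)
  have hfw := (Finset.sum_fiberwise_of_maps_to (s := A) (t := T) (g := V)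
    (fun q hq => by rw [hT]; exact Finset.mem_image_of_mem V hq) (fun q : ℕ => Real.log (q : ℝ))).symm
  have hinv : (Real.log 2)⁻¹ ≤ 3 / 2 := by
    have := Real.log_two_gt_d9
    rw [inv_le_comm₀ hlog2 (by norm_num)]
    linarith
  calc ∑ q ∈ A, Real.log q
      = ∑ v ∈ T, ∑ q ∈ A.filter (fun q => V q = v), Real.log q := hfw
    _ ≤ ∑ v ∈ T, ((P.localHeight v : ℝ) - 1) :=
        Finset.sum_le_sum fun v hv => hfib v hv _ (Finset.filter_subset _ _)
          (fun q hq => (Finset.mem_filter.mp hq).2)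
    _ ≤ ∑ v ∈ T, (Real.log 2)⁻¹ * ((P.localHeight v : ℝ) * Real.log (absNorm v.asIdeal)) := by
        refine Finset.sum_le_sum fun v hv => ?_
        have hh : (1 : ℝ) ≤ P.localHeight v := by
          have : 0 < P.localHeight v := hTpot v hv
          exact_mod_cast this
        have hN : Real.log 2 ≤ Real.log (absNorm v.asIdeal) :=
          Real.log_le_log (by norm_num) (two_le_absNorm P v)
        rw [← mul_assoc, mul_comm ((Real.log 2)⁻¹), mul_assoc]
        calc (P.localHeight v : ℝ) - 1 ≤ (P.localHeight v : ℝ) * 1 := by linarith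
          _ ≤ (P.localHeight v : ℝ) * ((Real.log 2)⁻¹ * Real.log (absNorm v.asIdeal)) := by
              refine mul_le_mul_of_nonneg_left ?_ (by linarith)
              rw [le_inv_mul_iff₀ hlog2, mul_one]
              exact hN
    _ = (Real.log 2)⁻¹ * ∑ v ∈ T, (P.localHeight v : ℝ) * Real.log (absNorm v.asIdeal) := by
        rw [Finset.mul_sum]
    _ ≤ (Real.log 2)⁻¹ * Real.log (absNorm P.W.jDenominatorIdeal) :=
        mul_le_mul_of_nonneg_left (P.sum_localHeight_mul_log_absNorm_le T hTpot)
          (inv_nonneg.mpr hlog2.le)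
    _ ≤ 3 / 2 * Real.log (absNorm P.W.jDenominatorIdeal) :=
        mul_le_mul_of_nonneg_right hinv
          (Real.log_nonneg (by exact_mod_cast absNorm_jDenominatorIdeal_pos P))

/-- **`x_{S°} - x_S ≤ (1 + 3/2) · log N(𝔇_j)`**: for a finite set `A` of rational primes each of
which lies under a prime of potentially multiplicative reduction of `E` or divides one of the local
heights of `E`, `∑_{p ∈ A} log p ≤ (5/2) · log N(𝔇_j)`.
[cite: MochizukiGenEll2010, proof of Cor. 4.3, p. 22] -/
theorem sum_log_le_five_halves_mul_log_absNorm_jDenominatorIdeal (A : Finset ℕ)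
    (hA : ∀ p ∈ A, p.Prime ∧ ∃ v : HeightOneSpectrum (𝓞 P.F), P.IsPotMult v ∧
      ((p : 𝓞 P.F) ∈ v.asIdeal ∨ (p : ℤ) ∣ P.localHeight v)) :
    ∑ p ∈ A, Real.log p ≤ 5 / 2 * Real.log (absNorm P.W.jDenominatorIdeal) := by
  classical
  set A₁ := A.filter (fun p : ℕ => ∃ v : HeightOneSpectrum (𝓞 P.F), P.IsPotMult v ∧
    (p : 𝓞 P.F) ∈ v.asIdeal)
  set A₂ := A.filter (fun p : ℕ => ¬ ∃ v : HeightOneSpectrum (𝓞 P.F), P.IsPotMult v ∧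
    (p : 𝓞 P.F) ∈ v.asIdeal)
  have hsplit : ∑ p ∈ A, Real.log p = ∑ p ∈ A₁, Real.log p + ∑ p ∈ A₂, Real.log p :=
    (Finset.sum_filter_add_sum_filter_not A (fun p : ℕ => ∃ v : HeightOneSpectrum (𝓞 P.F),
      P.IsPotMult v ∧ (p : 𝓞 P.F) ∈ v.asIdeal) (fun p : ℕ => Real.log p)).symm
  have h1 : ∑ p ∈ A₁, Real.log p ≤ Real.log (absNorm P.W.jDenominatorIdeal) := by
    refine P.sum_log_le_log_absNorm_jDenominatorIdeal_of_isPotMult A₁ ?_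
    intro p hp
    obtain ⟨hpA, hv⟩ := Finset.mem_filter.mp hp
    exact ⟨(hA p hpA).1, hv⟩
  have h2 : ∑ p ∈ A₂, Real.log p ≤ 3 / 2 * Real.log (absNorm P.W.jDenominatorIdeal) := by
    refine P.sum_log_le_of_dvd_localHeight A₂ ?_
    intro p hp
    obtain ⟨hpA, hnot⟩ := Finset.mem_filter.mp hp
    obtain ⟨hprime, v, hv, h⟩ := hA p hpA
    rcases h with h | h
    · exact absurd ⟨v, hv, h⟩ hnot
    · exact ⟨hprime, v, hv, h⟩
  linarith

/-- The same bound in the normalisation of [GenEll] §3: `∑_{p ∈ A} log p ≤ (5/2) · d · deg_∞(P)`,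
`d = [F:ℚ]` (`d · deg_∞ = log N(𝔇_j)` by definition of `GenEll.EllPoint.degInf`); print has
`(1 + 3/2) · 23040 d · deg_∞([E_L])`. [cite: MochizukiGenEll2010, proof of Cor. 4.3, p. 22] -/
theorem sum_log_le_five_halves_mul_degree_mul_degInf (A : Finset ℕ)
    (hA : ∀ p ∈ A, p.Prime ∧ ∃ v : HeightOneSpectrum (𝓞 P.F), P.IsPotMult v ∧
      ((p : 𝓞 P.F) ∈ v.asIdeal ∨ (p : ℤ) ∣ P.localHeight v)) :
    ∑ p ∈ A, Real.log p ≤ 5 / 2 * ((P.degree : ℝ) * P.degInf) := by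
  have hd : (P.degree : ℝ) ≠ 0 := by exact_mod_cast P.degree_pos.ne'
  have : (P.degree : ℝ) * P.degInf = Real.log (absNorm P.W.jDenominatorIdeal) := by
    simp only [EllPoint.degInf]
    field_simp
  rw [this]
  exact P.sum_log_le_five_halves_mul_log_absNorm_jDenominatorIdeal A hA

end EllPoint

end Literature.NumberTheory.DiophantineGeometry.GenEll
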